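import Summits.ABC.ABC.Theorems.IsogenyGlueCongruenceEllipticGluingPrimeBoundStubGeomIsotypicProjector
import Summits.ABC.ABC.Theorems.IsogenyGlueCongruenceEllipticGluingPrimeBoundStubIsotypicDichotomy
import Literature.AlgebraicGeometry.Motives.AbelianVarietyEndGaloisFinite
import HarnessLib

/-!
# Big-image torsion core, helpers 4/5: `End(P_K̄)` acting on `P(K̄)`; the corner evaluation

Helper file (4/5) for stub `stub_bigImageTorsionCore` ((N†), the big-image torsion core) of
line `Sketch` (isotypic–Minkowski reduction) of crux U
`Summit.ABC.ABC.Theses.IsogenyGlueCongruence.EllipticGluingPrimeBound` (stmt-ABC-13919); the stub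
itself is proved in `…EllipticGluingPrimeBoundStubBigImageTorsionCore`.

* `pointsEnd_comp` (registered sub-goal), `pointsEnd_baseChange` and the additive forms
    `act_apply`, `act_comp`,
  `act_baseChange`, `act_add`, `act_zero`, `act_neg`, `act_galConj_smul` — the action of
  `r ∈ End(P_K̄)` on `P(K̄) = P.geomPoints` (the tree's multiplicative `AbelianVariety.pointsEnd`,
  made additive), its compatibility with composition, base change (`geomPointsMap`), sums and
  the Galois action (`pointsEnd_galConj`: `(σ • r)(σ • y) = σ • r(y)`);
* `corner_ev_smul`, `corner_comp`, `corner_nsmul` — the corner evaluation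
  `ev f = snd ∘ (fst_K̄ ≫ f ≫ inr_K̄) ∘ inl : E(K̄) → A(K̄)` of `f : E_K̄ → A_K̄` through the points
  of `(E ⊞ A)_K̄`: Galois compatibility with the corner action on `Hom(E_K̄, A_K̄)`,
  multiplicativity, and `[N]`.

Design: the additive action is written
`((AddMonoidHom.id P.geomPoints).comp (MonoidHom.toAdditive (P.pointsEnd K̄ r))).comp
(AddMonoidHom.id P.geomPoints)` so that its type is literally `P.geomPoints →+ P.geomPoints`
(the synonym `geomPoints` is not reducible); no definition is introduced. Everything is proved;
no named fact. Deliberately NOT here: isotypy and the Hom-lattice (helpers 5/5).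
-/

noncomputable section

-- `Summit.<Summit>.<Problem>` is the mandated summit-side namespace (CONVENTIONS §2); for the
-- single-conjunct summit `ABC` the two coincide, so the duplicate `ABC.ABC` is deliberate.
set_option linter.dupNamespace false

namespace Summit.ABC.ABC.Theorems.IsotypicMinkowski

open scoped AddSubgroup

open CategoryTheory CategoryTheory.Limits AlgebraicGeometry
open Literature.AlgebraicGeometry.Motives
open Summit.ABC.ABC.Theses.IsogenyGlueCongruence

/-! ## Points of `P_L` acted on by `End(P_L)` (`pointsEnd_comp` is a registered sub-goal of the stub) -/

section PointsEnd

open Literature.AlgebraicGeometry.Motives.AbelianVariety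

/-- `pointsEnd` is compatible with composition: `(r ≫ s)(x) = s(r(x))`. [folklore] -/
theorem pointsEnd_comp {K : Type} [Field K] (L : Type) [Field L] [Algebra K L] (P : AbelianVariety
    K)
    (r s : P.baseChange L ⟶ P.baseChange L) (x : P.Points L) :
    P.pointsEnd L (r ≫ s) x = P.pointsEnd L s (P.pointsEnd L r x) := by
  change (P.pointsMulEquiv L).symm (P.pointsMulEquiv L x ≫ (r ≫ s).hom.hom.hom) =
    (P.pointsMulEquiv L).symm (P.pointsMulEquiv L ((P.pointsMulEquiv L).symm
      (P.pointsMulEquiv L x ≫ r.hom.hom.hom)) ≫ s.hom.hom.hom)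
  rw [MulEquiv.apply_symm_apply, Category.assoc]
  rfl

variable {K : Type} [Field K] (L : Type) [Field L] [Algebra K L] (P : AbelianVariety K)

set_option backward.isDefEq.respectTransparency false in
/-- A base-changed endomorphism `g_L` acts on `P(L)` as `g` does: `g_L(x) = x ≫ g`. [folklore] -/
theorem pointsEnd_baseChange (g : P ⟶ P) (x : P.Points L) :
    P.pointsEnd L (Hom.baseChange L g) x = AlgPoints.map g.hom.hom.hom x := by
  apply Over.OverMorphism.ext
  rw [pointsEnd_left, toSchemeHom_baseChange_comp_fst, ← Category.assoc,
    pointsEquiv_apply_left_comp_fst]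
  rfl

end PointsEnd

namespace BigImage

section GeomPoints

open Literature.AlgebraicGeometry.Motives.AbelianVariety

variable {K : Type} [Field K] (P : AbelianVariety K)

/-! The additive action of `r ∈ End(P_K̄)` on `P(K̄) = P.geomPoints` is written
`((AddMonoidHom.id P.geomPoints).comp (MonoidHom.toAdditive (P.pointsEnd K̄ r))).comp
(AddMonoidHom.id P.geomPoints)`: `MonoidHom.toAdditive` of the multiplicative `pointsEnd`,
sandwiched between identities so that its type is literally `P.geomPoints →+ P.geomPoints`
(the synonym `geomPoints = Additive (P.Points K̄)` is not reducible). No definition is introduced. -/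

/-- Unfolding the additive action: `r(x) = ofMul (pointsEnd r (toMul x))`. [folklore] -/
theorem act_apply (r : P.baseChange (AlgebraicClosure K) ⟶ P.baseChange (AlgebraicClosure K))
    (x : P.geomPoints) :
    ((AddMonoidHom.id P.geomPoints).comp (MonoidHom.toAdditive (P.pointsEnd (AlgebraicClosure K)
        (r)))).comp
        (AddMonoidHom.id P.geomPoints) x =
      Additive.ofMul (P.pointsEnd (AlgebraicClosure K) r (Additive.toMul x)) := rfl

/-- On `P(K̄)`: `(r ≫ s)(x) = s(r(x))`. [folklore] -/
theorem act_comp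
    (r s : P.baseChange (AlgebraicClosure K) ⟶ P.baseChange (AlgebraicClosure K))
    (x : P.geomPoints) :
    ((AddMonoidHom.id P.geomPoints).comp (MonoidHom.toAdditive (P.pointsEnd (AlgebraicClosure K) (r
        ≫ s)))).comp
        (AddMonoidHom.id P.geomPoints) x =
      ((AddMonoidHom.id P.geomPoints).comp (MonoidHom.toAdditive (P.pointsEnd (AlgebraicClosure K)
          (s)))).comp
        (AddMonoidHom.id P.geomPoints)
        (((AddMonoidHom.id P.geomPoints).comp (MonoidHom.toAdditive (P.pointsEnd (AlgebraicClosure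
            K) (r)))).comp
        (AddMonoidHom.id P.geomPoints) x) := by
  rw [act_apply, act_apply, act_apply, pointsEnd_comp]
  rfl

/-- On `P(K̄)`: a base-changed endomorphism acts as `geomPointsMap`. [folklore] -/
theorem act_baseChange (g : P ⟶ P) (x : P.geomPoints) :
    ((AddMonoidHom.id P.geomPoints).comp (MonoidHom.toAdditive (P.pointsEnd (AlgebraicClosure K)
        (Hom.baseChange (AlgebraicClosure K) g)))).comp
        (AddMonoidHom.id P.geomPoints) x = Hom.geomPointsMap g x := by
  rw [act_apply, pointsEnd_baseChange]
  rfl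

/-- On `P(K̄)`: `(r + s)(x) = r(x) + s(x)`. [folklore] -/
theorem act_add
    (r s : P.baseChange (AlgebraicClosure K) ⟶ P.baseChange (AlgebraicClosure K))
    (x : P.geomPoints) :
    ((AddMonoidHom.id P.geomPoints).comp (MonoidHom.toAdditive (P.pointsEnd (AlgebraicClosure K) (r
        + s)))).comp
        (AddMonoidHom.id P.geomPoints) x =
      ((AddMonoidHom.id P.geomPoints).comp (MonoidHom.toAdditive (P.pointsEnd (AlgebraicClosure K)
          (r)))).comp
        (AddMonoidHom.id P.geomPoints) x +
        ((AddMonoidHom.id P.geomPoints).comp (MonoidHom.toAdditive (P.pointsEnd (AlgebraicClosure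
            K) (s)))).comp
        (AddMonoidHom.id P.geomPoints) x := by
  rw [act_apply, act_apply, act_apply, pointsEnd_add]
  rfl

/-- On `P(K̄)`: the zero endomorphism acts as `0`. [folklore] -/
theorem act_zero (x : P.geomPoints) :
    ((AddMonoidHom.id P.geomPoints).comp (MonoidHom.toAdditive (P.pointsEnd (AlgebraicClosure K)
        (0)))).comp
        (AddMonoidHom.id P.geomPoints) x = 0 := by
  have h := act_add P 0 0 x
  rw [add_zero] at h
  exact left_eq_add.1 h

/-- On `P(K̄)`: `(-r)(x) = -r(x)`. [folklore] -/
theorem act_neg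
    (r : P.baseChange (AlgebraicClosure K) ⟶ P.baseChange (AlgebraicClosure K)) (x : P.geomPoints) :
    ((AddMonoidHom.id P.geomPoints).comp (MonoidHom.toAdditive (P.pointsEnd (AlgebraicClosure K)
        (-r)))).comp
        (AddMonoidHom.id P.geomPoints) x =
      -((AddMonoidHom.id P.geomPoints).comp (MonoidHom.toAdditive (P.pointsEnd (AlgebraicClosure K)
          (r)))).comp
        (AddMonoidHom.id P.geomPoints) x := by
  have h := act_add P (-r) r x
  rw [neg_add_cancel, act_zero] at h
  exact (neg_eq_of_add_eq_zero_left h.symm).symm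

/-- On `P(K̄)`: the Galois conjugate acts by `(σ • r)(σ • y) = σ • r(y)` (`pointsEnd_galConj`).
[folklore] -/
theorem act_galConj_smul (σ : Field.absoluteGaloisGroup K)
    (r : P.baseChange (AlgebraicClosure K) ⟶ P.baseChange (AlgebraicClosure K))
    (y : P.geomPoints) :
    ((AddMonoidHom.id P.geomPoints).comp (MonoidHom.toAdditive (P.pointsEnd (AlgebraicClosure K)
        (P.galConj (AlgebraicClosure K) (Field.absoluteGaloisGroup.toAlgEquiv K σ) r)))).comp
        (AddMonoidHom.id P.geomPoints) (σ • y) =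
      σ • ((AddMonoidHom.id P.geomPoints).comp (MonoidHom.toAdditive (P.pointsEnd (AlgebraicClosure
          K) (r)))).comp
        (AddMonoidHom.id P.geomPoints) y := by
  rw [act_apply, act_apply]
  apply Additive.toMul.injective
  change P.pointsEnd _ (P.galConj _ (Field.absoluteGaloisGroup.toAlgEquiv K σ) r)
      ((Field.absoluteGaloisGroup.toAlgEquiv K σ) • Additive.toMul y) =
    (Field.absoluteGaloisGroup.toAlgEquiv K σ) • P.pointsEnd _ r (Additive.toMul y)
  rw [pointsEnd_galConj, inv_smul_smul]

end GeomPoints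

/-! ## The corner evaluation `Hom(E_K̄, A_K̄) × E(K̄) → A(K̄)` through `(E ⊞ A)(K̄)` -/

section Corner

open Literature.AlgebraicGeometry.Motives.AbelianVariety

variable {K : Type} [Field K] (E A : AbelianVariety K)

/-- **Galois-compatibility of the corner evaluation.** For `f : E_K̄ → A_K̄` write
`ev f := snd ∘ (fst_K̄ ≫ f ≫ inr_K̄) ∘ inl : E(K̄) → A(K̄)` (through the points of `(E ⊞ A)_K̄`)
and `σ • f := inl_K̄ ≫ σ(fst_K̄ ≫ f ≫ inr_K̄) ≫ snd_K̄` (the corner of `galConj`). Then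
`ev (σ • f) (σ • y) = σ • ev f y`. [folklore] -/
theorem corner_ev_smul (σ : Field.absoluteGaloisGroup K)
    (f : E.baseChange (AlgebraicClosure K) ⟶ A.baseChange (AlgebraicClosure K))
    (y : E.geomPoints) :
    AbelianVariety.Hom.geomPointsMap (biprod.snd : E ⊞ A ⟶ A)
      (((AddMonoidHom.id (E ⊞ A).geomPoints).comp (MonoidHom.toAdditive ((E ⊞ A).pointsEnd
          (AlgebraicClosure K)
          (AbelianVariety.Hom.baseChange (AlgebraicClosure K) (biprod.fst : E ⊞ A ⟶ E) ≫
              (AbelianVariety.Hom.baseChange (AlgebraicClosure K) (biprod.inl : E ⟶ E ⊞ A) ≫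
            (E ⊞ A).galConj (AlgebraicClosure K) (Field.absoluteGaloisGroup.toAlgEquiv K σ)
              (AbelianVariety.Hom.baseChange (AlgebraicClosure K) (biprod.fst : E ⊞ A ⟶ E) ≫ f ≫
                  AbelianVariety.Hom.baseChange (AlgebraicClosure K) (biprod.inr : A ⟶ E ⊞ A)) ≫
            AbelianVariety.Hom.baseChange (AlgebraicClosure K) (biprod.snd : E ⊞ A ⟶ A)) ≫
                AbelianVariety.Hom.baseChange (AlgebraicClosure K) (biprod.inr : A ⟶ E ⊞
                A))))).comp (AddMonoidHom.id (E ⊞ A).geomPoints)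
        (AbelianVariety.Hom.geomPointsMap (biprod.inl : E ⟶ E ⊞ A) (σ • y))) =
      σ • AbelianVariety.Hom.geomPointsMap (biprod.snd : E ⊞ A ⟶ A)
      (((AddMonoidHom.id (E ⊞ A).geomPoints).comp (MonoidHom.toAdditive ((E ⊞ A).pointsEnd
          (AlgebraicClosure K)
          (AbelianVariety.Hom.baseChange (AlgebraicClosure K) (biprod.fst : E ⊞ A ⟶ E) ≫ f ≫
              AbelianVariety.Hom.baseChange (AlgebraicClosure K) (biprod.inr : A ⟶ E ⊞ A))))).comp
              (AddMonoidHom.id (E ⊞ A).geomPoints)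
        (AbelianVariety.Hom.geomPointsMap (biprod.inl : E ⟶ E ⊞ A) y)) := by
  -- projections of `(E ⊞ A)(K̄)`
  have h1 : ∀ w : A.geomPoints, Hom.geomPointsMap (biprod.snd : E ⊞ A ⟶ A)
      (Hom.geomPointsMap (biprod.inr : A ⟶ E ⊞ A) w) = w := fun w ↦ by
    rw [← AddMonoidHom.comp_apply, ← Hom.geomPointsMap_comp, biprod.inr_snd,
      Hom.geomPointsMap_id, AddMonoidHom.id_apply]
  have h2 : ∀ w : E.geomPoints, Hom.geomPointsMap (biprod.fst : E ⊞ A ⟶ E)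
      (Hom.geomPointsMap (biprod.inl : E ⟶ E ⊞ A) w) = w := fun w ↦ by
    rw [← AddMonoidHom.comp_apply, ← Hom.geomPointsMap_comp, biprod.inl_fst,
      Hom.geomPointsMap_id, AddMonoidHom.id_apply]
  simp only [Category.assoc]
  rw [← Category.assoc, ← Hom.baseChange_comp, ← Hom.baseChange_comp, act_comp, act_comp,
    act_baseChange, act_baseChange, Hom.geomPointsMap_comp, Hom.geomPointsMap_comp,
    AddMonoidHom.comp_apply (Hom.geomPointsMap (biprod.inl : E ⟶ E ⊞ A))
      (Hom.geomPointsMap (biprod.fst : E ⊞ A ⟶ E)),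
    AddMonoidHom.comp_apply (Hom.geomPointsMap (biprod.inr : A ⟶ E ⊞ A))
      (Hom.geomPointsMap (biprod.snd : E ⊞ A ⟶ A)), h1, h2, Hom.geomPointsMap_smul,
    act_galConj_smul, Hom.geomPointsMap_smul]

/-- **The corner evaluation is multiplicative**: for `π : A_K̄ → E_K̄`, `ι' : E_K̄ → A_K̄` the
endomorphism `π ≫ ι'` of `A_K̄` acts on `A(K̄)` as `ev ι' ∘ coev π`, all through the points of
`(E ⊞ A)_K̄`. [folklore] -/
theorem corner_comp (π : A.baseChange (AlgebraicClosure K) ⟶ E.baseChange (AlgebraicClosure K))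
    (ι' : E.baseChange (AlgebraicClosure K) ⟶ A.baseChange (AlgebraicClosure K))
    (Q : A.geomPoints) :
    AbelianVariety.Hom.geomPointsMap (biprod.snd : E ⊞ A ⟶ A)
      (((AddMonoidHom.id (E ⊞ A).geomPoints).comp (MonoidHom.toAdditive ((E ⊞ A).pointsEnd
          (AlgebraicClosure K)
          (AbelianVariety.Hom.baseChange (AlgebraicClosure K) (biprod.snd : E ⊞ A ⟶ A) ≫ (π ≫ ι') ≫
              AbelianVariety.Hom.baseChange (AlgebraicClosure K) (biprod.inr : A ⟶ E ⊞ A))))).comp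
              (AddMonoidHom.id (E ⊞ A).geomPoints)
        (AbelianVariety.Hom.geomPointsMap (biprod.inr : A ⟶ E ⊞ A) Q)) =
      AbelianVariety.Hom.geomPointsMap (biprod.snd : E ⊞ A ⟶ A)
      (((AddMonoidHom.id (E ⊞ A).geomPoints).comp (MonoidHom.toAdditive ((E ⊞ A).pointsEnd
          (AlgebraicClosure K)
          (AbelianVariety.Hom.baseChange (AlgebraicClosure K) (biprod.fst : E ⊞ A ⟶ E) ≫ ι' ≫
              AbelianVariety.Hom.baseChange (AlgebraicClosure K) (biprod.inr : A ⟶ E ⊞ A))))).comp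
              (AddMonoidHom.id (E ⊞ A).geomPoints)
        (AbelianVariety.Hom.geomPointsMap (biprod.inl : E ⟶ E ⊞ A)
            (AbelianVariety.Hom.geomPointsMap (biprod.fst : E ⊞ A ⟶ E)
          (((AddMonoidHom.id (E ⊞ A).geomPoints).comp (MonoidHom.toAdditive ((E ⊞ A).pointsEnd
              (AlgebraicClosure K)
          (AbelianVariety.Hom.baseChange (AlgebraicClosure K) (biprod.snd : E ⊞ A ⟶ A) ≫ π ≫
              AbelianVariety.Hom.baseChange (AlgebraicClosure K) (biprod.inl : E ⟶ E ⊞ A))))).comp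
              (AddMonoidHom.id (E ⊞ A).geomPoints)
            (AbelianVariety.Hom.geomPointsMap (biprod.inr : A ⟶ E ⊞ A) Q))))) := by
  have hif : AbelianVariety.Hom.baseChange (AlgebraicClosure K) (biprod.inl : E ⟶ E ⊞ A) ≫
      AbelianVariety.Hom.baseChange (AlgebraicClosure K) (biprod.fst : E ⊞ A ⟶ E) = 𝟙 _ := by
    rw [← AbelianVariety.Hom.baseChange_comp, biprod.inl_fst, AbelianVariety.Hom.baseChange_id]
  have hfac : AbelianVariety.Hom.baseChange (AlgebraicClosure K) (biprod.snd : E ⊞ A ⟶ A) ≫ (π ≫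
      ι') ≫ AbelianVariety.Hom.baseChange (AlgebraicClosure K) (biprod.inr : A ⟶ E ⊞ A) =
      (AbelianVariety.Hom.baseChange (AlgebraicClosure K) (biprod.snd : E ⊞ A ⟶ A) ≫ π ≫
          AbelianVariety.Hom.baseChange (AlgebraicClosure K) (biprod.inl : E ⟶ E ⊞ A)) ≫
      (AbelianVariety.Hom.baseChange (AlgebraicClosure K) (biprod.fst : E ⊞ A ⟶ E) ≫ ι' ≫
          AbelianVariety.Hom.baseChange (AlgebraicClosure K) (biprod.inr : A ⟶ E ⊞ A)) := by
    simp only [Category.assoc]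
    rw [reassoc_of% hif]
  have hG : (AbelianVariety.Hom.baseChange (AlgebraicClosure K) (biprod.snd : E ⊞ A ⟶ A) ≫ π ≫
      AbelianVariety.Hom.baseChange (AlgebraicClosure K) (biprod.inl : E ⟶ E ⊞ A)) ≫
      AbelianVariety.Hom.baseChange (AlgebraicClosure K) (biprod.fst : E ⊞ A ⟶ E) ≫
          AbelianVariety.Hom.baseChange (AlgebraicClosure K) (biprod.inl : E ⟶ E ⊞ A) =
      AbelianVariety.Hom.baseChange (AlgebraicClosure K) (biprod.snd : E ⊞ A ⟶ A) ≫ π ≫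
          AbelianVariety.Hom.baseChange (AlgebraicClosure K) (biprod.inl : E ⟶ E ⊞ A) := by
    simp only [Category.assoc]
    rw [reassoc_of% hif]
  rw [hfac, act_comp]
  have key : ∀ w : (E ⊞ A).geomPoints,
      Hom.geomPointsMap (biprod.inl : E ⟶ E ⊞ A) (Hom.geomPointsMap (biprod.fst : E ⊞ A ⟶ E)
        (((AddMonoidHom.id (E ⊞ A).geomPoints).comp (MonoidHom.toAdditive ((E ⊞ A).pointsEnd
            (AlgebraicClosure K)
          (AbelianVariety.Hom.baseChange (AlgebraicClosure K) (biprod.snd : E ⊞ A ⟶ A) ≫ π ≫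
              AbelianVariety.Hom.baseChange (AlgebraicClosure K) (biprod.inl : E ⟶ E ⊞ A))))).comp
              (AddMonoidHom.id (E ⊞ A).geomPoints) w)) =
      ((AddMonoidHom.id (E ⊞ A).geomPoints).comp (MonoidHom.toAdditive ((E ⊞ A).pointsEnd
          (AlgebraicClosure K)
          (AbelianVariety.Hom.baseChange (AlgebraicClosure K) (biprod.snd : E ⊞ A ⟶ A) ≫ π ≫
              AbelianVariety.Hom.baseChange (AlgebraicClosure K) (biprod.inl : E ⟶ E ⊞ A))))).comp
              (AddMonoidHom.id (E ⊞ A).geomPoints) w := by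
    intro w
    rw [← AddMonoidHom.comp_apply (Hom.geomPointsMap (biprod.inl : E ⟶ E ⊞ A)),
      ← Hom.geomPointsMap_comp, ← act_baseChange, Hom.baseChange_comp, ← act_comp, hG]
  rw [key]

/-- **Multiplication by `N` through the corner**: `[N]_{A_K̄}` acts on `A(K̄)` as `N •`. [folklore] -/
theorem corner_nsmul (N : ℕ) (Q : A.geomPoints) :
    AbelianVariety.Hom.geomPointsMap (biprod.snd : E ⊞ A ⟶ A)
      (((AddMonoidHom.id (E ⊞ A).geomPoints).comp (MonoidHom.toAdditive ((E ⊞ A).pointsEnd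
          (AlgebraicClosure K)
          (AbelianVariety.Hom.baseChange (AlgebraicClosure K) (biprod.snd : E ⊞ A ⟶ A) ≫ (N • 𝟙
              (A.baseChange (AlgebraicClosure K))) ≫ AbelianVariety.Hom.baseChange
              (AlgebraicClosure K) (biprod.inr : A ⟶ E ⊞ A))))).comp (AddMonoidHom.id (E ⊞
              A).geomPoints)
        (AbelianVariety.Hom.geomPointsMap (biprod.inr : A ⟶ E ⊞ A) Q)) = N • Q := by
  have h : AbelianVariety.Hom.baseChange (AlgebraicClosure K) (biprod.snd : E ⊞ A ⟶ A) ≫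
      (N • 𝟙 (A.baseChange (AlgebraicClosure K))) ≫ AbelianVariety.Hom.baseChange (AlgebraicClosure
          K) (biprod.inr : A ⟶ E ⊞ A) =
      AbelianVariety.Hom.baseChange (AlgebraicClosure K)
        (N • (biprod.snd ≫ biprod.inr : E ⊞ A ⟶ E ⊞ A)) := by
    rw [Preadditive.nsmul_comp, Category.id_comp, Preadditive.comp_nsmul, baseChange_nsmul,
      AbelianVariety.Hom.baseChange_comp]
  rw [h, act_baseChange, AbelianVariety.geomPointsMap_nsmul_apply, map_nsmul,
    ← AddMonoidHom.comp_apply (Hom.geomPointsMap (biprod.snd ≫ biprod.inr : E ⊞ A ⟶ E ⊞ A)),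
    ← Hom.geomPointsMap_comp,
    ← AddMonoidHom.comp_apply (Hom.geomPointsMap (biprod.snd : E ⊞ A ⟶ A)),
    ← Hom.geomPointsMap_comp]
  simp only [Category.assoc, biprod.inr_snd, Category.comp_id, Hom.geomPointsMap_id,
    AddMonoidHom.id_apply]

end Corner

end BigImage

end Summit.ABC.ABC.Theorems.IsotypicMinkowski

end
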